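import Mathlib
import Summits.MatrixMultiplication.MatrixMultiplication.Theorems.AutomaticSTPPDesignsAutomaticPackingThesisUniformNormalForm

/-!
# `AutomaticPackingThesis` — how large a uniform witness must be (InfimumNotMinimum, quantified)

Route `MatrixMultiplication/AutomaticSTPPDesigns`, crux `stmt-MatrixMultiplication-7356`
(`AutomaticPackingThesis`), line `Sketch` (lead c2, cycle 3). Support file (`--supports`).

By the uniform normal form (`automaticPackingThesis_iff_uniformBeat`, file `…UniformNormalForm.lean`)
a witness of the crux at exponent `τ` is an STPP design of `n` triples of `M`-blocks in some
`ℤ/(p^K)` with `p^K < n · (M³)^τ`. This file records what the packing inequalities already in the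
tree force on such a witness when `2/3 < τ ≤ 1` (`uniformWitness_size`):

* `M³ ≤ p^K` — each triple tiles injectively (`AddSimultaneousTPP.card_mul_card_mul_card_le`);
* `(2n − 1) M² ≤ p^K` — the two-term packing inequality
  (`AutomaticDesignBelowFourFifths.sum_erase_card_mul_card_add_sum_le`);
* hence `n ≥ 2`, `M^(3τ−2) > 2 − 1/n ≥ 3/2` and `n > M^(3−3τ)`.

So witnesses necessarily blow up as `τ ↓ 2/3`: `M > (3/2)^(1/(3τ−2))` (`τ = 0.8`: `M ≥ 3`;
`τ = 0.7`: `M ≥ 58`, `p^K ≥ 58³ = 195112`, `n ≥ 39`; `τ = 0.68`: `M ≥ 25252`). This is the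
crux-specific, quantitative form of the catalogued `InfimumNotMinimumBarrier` (per-`τ` witnesses,
no single design works for all `τ`), consistent with the crux and with `RegularTowerGap` (proved).

## References

* J. Blasiak, T. Church, H. Cohn, J. A. Grochow, E. Naslund, W. F. Sawin, C. Umans, *On cap sets and
  the group-theoretic approach to matrix multiplication*, Discrete Analysis 2017:3, §2 (packing bounds).
* H. Cohn, R. Kleinberg, B. Szegedy, C. Umans, *Group-theoretic algorithms for matrix
  multiplication*, FOCS 2005, arXiv:math/0511460, Def. 5.1.
-/

-- single-conjunct summit: the mandated namespace repeats `MatrixMultiplication`.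
set_option linter.dupNamespace false

noncomputable section

namespace Summit.MatrixMultiplication.MatrixMultiplication.Theorems

namespace AutomaticPackingThesis

open Finset Literature.Combinatorics.Additive Literature.Computability.AlgebraicComplexity

/-- **Packing facts for a uniform design** (`n ≥ 1` triples of `M`-blocks, `M ≥ 1`, in `ℤ/(p^K)`):
the tiling bound `M³ ≤ p^K` and the two-term packing inequality `(2n − 1) M² ≤ p^K`.
[cite: BlasiakChurchCohnGrochowNaslundSawinUmans2017, §2] -/
theorem uniform_packing (p K n M : ℕ) (hp : 0 < p) (hn : 0 < n) (hM : 0 < M)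
    (A B C : Fin n → Finset (ZMod (p ^ K))) (hS : IsSTPP A B C)
    (hcard : ∀ i, (A i).card = M ∧ (B i).card = M ∧ (C i).card = M) :
    M ^ 3 ≤ p ^ K ∧ (2 * n - 1) * M ^ 2 ≤ p ^ K := by
  classical
  haveI : NeZero (p ^ K) := ⟨pow_ne_zero _ hp.ne'⟩
  have h := (isSTPP_iff_addSimultaneousTPP _ _ _).1 hS
  have hne : ∀ (D : Fin n → Finset (ZMod (p ^ K))), (∀ i, (D i).card = M) → ∀ i, (D i).Nonempty :=
    fun D hD i => Finset.card_pos.1 (by rw [hD i]; exact hM)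
  set i₀ : Fin n := ⟨0, hn⟩ with hi₀
  refine ⟨?_, ?_⟩
  · have ht := h.card_mul_card_mul_card_le i₀
    rw [(hcard i₀).1, (hcard i₀).2.1, (hcard i₀).2.2, ZMod.card] at ht
    calc M ^ 3 = M * M * M := by ring
      _ ≤ p ^ K := ht
  · have h2 := AutomaticDesignBelowFourFifths.sum_erase_card_mul_card_add_sum_le h
      (hne B fun i => (hcard i).2.1) (hne C fun i => (hcard i).2.2) i₀
    have e1 : ∑ i ∈ univ.erase i₀, (A i).card * (B i).card = (n - 1) * (M * M) := by
      rw [Finset.sum_congr rfl fun i _ => by rw [(hcard i).1, (hcard i).2.1], sum_const,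
        card_erase_of_mem (mem_univ _), card_univ, Fintype.card_fin, smul_eq_mul]
    have e2 : ∑ i, (A i).card * (C i).card = n * (M * M) := by
      rw [Finset.sum_congr rfl fun i _ => by rw [(hcard i).1, (hcard i).2.2], sum_const, card_univ,
        Fintype.card_fin, smul_eq_mul]
    rw [e1, e2, ZMod.card] at h2
    have : (2 * n - 1) * M ^ 2 = (n - 1) * (M * M) + n * (M * M) := by
      obtain ⟨k, rfl⟩ : ∃ k, n = k + 1 := ⟨n - 1, by omega⟩
      simp only [Nat.add_sub_cancel, pow_two]
      have : 2 * (k + 1) - 1 = k + (k + 1) := by omega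
      rw [this]
      ring
    rw [this]
    exact h2

/-- **How large a uniform witness must be.** If `n` triples of `M`-blocks (`M ≥ 2`) form an STPP
design in `ℤ/(p^K)` beating the host at an exponent `τ ≤ 1` (for the crux: `τ ∈ (2/3, 1]`),
`p^K < n · (M³)^τ`, then
`n ≥ 2`, `M³ ≤ p^K`, `(2n − 1) M² ≤ p^K`, `M^(3τ−2) > 3/2` and `M^(3−3τ) < n`. In particular
`M > (3/2)^(1/(3τ−2))` → ∞ as `τ ↓ 2/3` (InfimumNotMinimum, quantified for this crux).
[folklore] -/
theorem uniformWitness_size (p K n M : ℕ) (hp : 0 < p) (A B C : Fin n → Finset (ZMod (p ^ K)))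
    (hS : IsSTPP A B C) (hcard : ∀ i, (A i).card = M ∧ (B i).card = M ∧ (C i).card = M)
    (hM : 2 ≤ M) {τ : ℝ} (hτ1 : τ ≤ 1)
    (hbeat : (p : ℝ) ^ K < n * ((M : ℝ) ^ 3) ^ τ) :
    2 ≤ n ∧ M ^ 3 ≤ p ^ K ∧ (2 * n - 1) * M ^ 2 ≤ p ^ K ∧
      (3 / 2 : ℝ) < (M : ℝ) ^ (3 * τ - 2) ∧ (M : ℝ) ^ (3 - 3 * τ) < n := by
  have hM0 : (0 : ℝ) < M := by exact_mod_cast (by omega : 0 < M)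
  have hM1 : (1 : ℝ) ≤ M := by exact_mod_cast (by omega : 1 ≤ M)
  -- rewrite the beat with a real exponent
  have h3τ : ((M : ℝ) ^ 3) ^ τ = (M : ℝ) ^ (3 * τ) := by
    rw [← Real.rpow_natCast _ 3, ← Real.rpow_mul hM0.le]
    norm_num
  rw [h3τ] at hbeat
  -- `n ≥ 1`
  have hn : 0 < n := by
    rcases Nat.eq_zero_or_pos n with h0 | h0
    · subst h0
      simp only [CharP.cast_eq_zero, zero_mul] at hbeat
      exact absurd hbeat (not_lt.2 (by positivity))
    · exact h0
  obtain ⟨hT, hP2⟩ := uniform_packing p K n M hp hn (by omega) A B C hS hcard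
  have hTr : (M : ℝ) ^ (3 : ℝ) ≤ (p : ℝ) ^ K := by
    rw [show (3 : ℝ) = ((3 : ℕ) : ℝ) by norm_num, Real.rpow_natCast]
    exact_mod_cast hT
  -- `M^(3τ) ≤ M^3`
  have hle3 : (M : ℝ) ^ (3 * τ) ≤ (M : ℝ) ^ (3 : ℝ) :=
    Real.rpow_le_rpow_of_exponent_le hM1 (by linarith)
  -- `n ≥ 2`
  have hn2 : 2 ≤ n := by
    by_contra hlt
    have hn1 : n = 1 := by omega
    subst hn1
    simp only [Nat.cast_one, one_mul] at hbeat
    exact absurd (hbeat.trans_le (hle3.trans hTr)) (lt_irrefl _)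
  refine ⟨hn2, hT, hP2, ?_, ?_⟩
  · -- `(2 - 1/n) M² ≤ p^K < n M^(3τ)` gives `3/2 ≤ 2 - 1/n < M^(3τ - 2)`
    have hP2r : ((2 * n - 1 : ℕ) : ℝ) * (M : ℝ) ^ 2 ≤ (p : ℝ) ^ K := by exact_mod_cast hP2
    have hcast : ((2 * n - 1 : ℕ) : ℝ) = 2 * n - 1 := by
      rw [Nat.cast_sub (by omega), Nat.cast_mul]
      norm_num
    rw [hcast] at hP2r
    have hnr : (2 : ℝ) ≤ n := by exact_mod_cast hn2
    have hsub : (M : ℝ) ^ (3 * τ - 2) = (M : ℝ) ^ (3 * τ) / (M : ℝ) ^ 2 := by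
      rw [Real.rpow_sub hM0, Real.rpow_two]
    rw [hsub, lt_div_iff₀ (by positivity)]
    have hkey : (2 * (n : ℝ) - 1) * (M : ℝ) ^ 2 < n * (M : ℝ) ^ (3 * τ) := hP2r.trans_lt hbeat
    -- `(3/2) M² · n ≤ (2n - 1) M²` as `3n/2 ≤ 2n - 1` for `n ≥ 2`
    have hn0 : (0 : ℝ) < n := by linarith
    nlinarith [sq_nonneg (M : ℝ), hkey, mul_pos hn0 (pow_pos hM0 2)]
  · -- `M³ ≤ p^K < n M^(3τ)` gives `M^(3 - 3τ) < n`
    have hsub : (M : ℝ) ^ (3 - 3 * τ) = (M : ℝ) ^ (3 : ℝ) / (M : ℝ) ^ (3 * τ) := by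
      rw [Real.rpow_sub hM0]
    rw [hsub, div_lt_iff₀ (Real.rpow_pos_of_pos hM0 _)]
    exact hTr.trans_lt hbeat

/-- Registered stub `stub_uniformWitnessSize` of crux stmt-MatrixMultiplication-7356 (line `Sketch`,
lead c2): verbatim `uniformWitness_size`. [folklore] -/
theorem stub_uniformWitnessSize (p K n M : ℕ) (hp : 0 < p) (A B C : Fin n → Finset (ZMod (p ^ K)))
    (hS : IsSTPP A B C) (hcard : ∀ i, (A i).card = M ∧ (B i).card = M ∧ (C i).card = M)
    (hM : 2 ≤ M) {τ : ℝ} (hτ1 : τ ≤ 1)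
    (hbeat : (p : ℝ) ^ K < n * ((M : ℝ) ^ 3) ^ τ) :
    2 ≤ n ∧ M ^ 3 ≤ p ^ K ∧ (2 * n - 1) * M ^ 2 ≤ p ^ K ∧
      (3 / 2 : ℝ) < (M : ℝ) ^ (3 * τ - 2) ∧ (M : ℝ) ^ (3 - 3 * τ) < n :=
  uniformWitness_size p K n M hp A B C hS hcard hM hτ1 hbeat

end AutomaticPackingThesis

end Summit.MatrixMultiplication.MatrixMultiplication.Theorems

end
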